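/-
Copyright (c) 2026. All rights reserved.
Released under Apache 2.0 license as described in the file LICENSE.
Authors: abc-iut cell, seat abc-iut-w6-d075 (gen 3; proof-only packaging of [AbsTopI] Thm 2.6 (iii) and the
general-Θ Thm 2.6 (v) over a Δ that is only ALMOST pro-Σ, on abc-iut-w6-d071's clause-one file and this
seat's clause-two file).
-/
import Literature.AnabelianGeometry.AbsoluteAnabelian.AbsTopIAlmostProSigmaClosers
import Literature.AnabelianGeometry.AbsoluteAnabelian.AbsTopIThm26vAlmostProSigma
import Literature.AnabelianGeometry.AbsoluteAnabelian.AbsTopIThm26vAlmostProSigmaRegime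
import Literature.AnabelianGeometry.AbsoluteAnabelian.AbsTopIThm26iiSigmaStarProofs
import HarnessLib

/-!
# [AbsTopI] Thm 2.6 (iii) (both clauses) and Thm 2.6 (v) (general `Θ`) packaged over a Δ that is ALMOST pro-`Σ`

S. Mochizuki, *Topics in Absolute Anabelian Geometry I: Generalities* (2012) [AbsTopI] (lit key
`paper:url-11ac98ba15fc`): Def 1.1 (iii) p. 10, Def 2.1 (i) p. 17 ("[almost pro-`Σ`] GFG-type"), Thm 2.6
(iii)/(v) p. 22, proof of (iii) p. 23 ("By applying the analogue of this conclusion for an arbitrary open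
subgroup `H ⊆ Π`, we thus obtain that `δ²_l(H) = 0` if `l ∉ Σ` … `θ²(Π) ⊆ Σ`. If the cardinality of `θ¹(Π)`
is `≥ 2` … `θ²(Π) = Σ`").

PROOF-ONLY packaging (no definition, no named fact) for the abc-iut row «THM26-ALMOST-PROSIGMA» (L4-lead
RULING #8i/#8j; E-L4 flag «pro-`Σ` essential at (iii) clause 1» discharged by abc-iut-w6-d071's
`AbsTopIThm26iiiClauseOneAlmostPro.lean`).  With clause ONE over `IsAlmostPro E.geom S`
(`thetaSet_two_subset_of_isAlmostPro`, `deltaInv_two_eq_zero_of_isAlmostPro`) and clause TWO over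
`IsAlmostPro` (this seat's `MLFBase.subset_thetaSet_two_of_hook_of_isAlmostPro`,
`subset_thetaSet_two_of_lem27iiiStep_of_isAlmostPro`), the typed Thm 2.6 (iii) and the general-`Θ` Thm 2.6
(v) closers of abc-iut-w6-d034 / abc-iut-w6-d073 re-key from `IsProSet` to `IsAlmostPro` by assembly:

* (clause one at every open `H ≤ Π` is abc-iut-w6-d071's `MLFBase.thetaSet_two_subset_of_isOpen_of_isAlmostPro`,
  `AbsTopIThm26vAlmostProSigmaRegime.lean`, consumed BY NAME;)
* `thm26iii_iff_of_isAlmostPro` — under clause one's hypotheses `E.Thm26iii S ⟺ (|θ¹(Π)| ≥ 2 ⟹ Σ ⊆ θ²(Π))`;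
* `MLFBase.thm26iii_of_hook_of_isAlmostPro`, `thm26iii_of_lem27iiiStep_of_isAlmostPro` — **the typed
  `E.Thm26iii S` for `Δ` ALMOST pro-`Σ`**, from MLF base data, `Π` tfg, `IsAlmostPro` and the Lemma 2.7 (iii)
  hook, resp. abc-iut-w6-d073's `Lem27iiiStep`; `thm26iii_open_of_lem27iiiStep_of_isAlmostPro` — both clauses
  at every open `H`;
* `MLFBase.thm26vFull_of_rank_of_lem27iiiStep_of_isAlmostPro` — **the general-`Θ` `E.Thm26vFull B` for `Δ`
  ALMOST pro-`Σ`** modulo ⟨Prop 2.2, `Π` tfg, the (ii)-rank identity per open `Π′`, Lemma 2.7 (iii)⟩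
  (abc-iut-w6-d071's `MLFBase.thm26vFull_of_rank_of_thm26iii_open_of_isAlmostPro` with `hiii` discharged);
  `MLFBase.thm26vFull_of_lem27iiiStep_of_isAlmostPro` — the same for EVERY `Σ ⊆ 𝔓𝔯𝔦𝔪𝔢𝔰`, the rank identity
  and the Lemma 2.7 (iii) input being used only when `Σ ⊇ 𝔓𝔯𝔦𝔪𝔢𝔰` (over `MLFBase.thm26vFull_of_isAlmostPro_of_tfg`);
* v2: `MLFBase.thm26vFull_of_sigmaStarCondition_of_lem27iiiStep_of_isAlmostPro` (+ `_of_geomTFG`) — the same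
  with the rank identity SUPPLIED by the printed inputs of (ii), splitting + (∗)_Σ
  (`exists_freeProlRank_open_eq_add_of_sigmaStar`).

Classical profinite group theory on landed files; OUR kernel check; [AbsTopI] refereed and undisputed; nothing
here bears on [IUTchIII] Cor. 3.12; no side is taken.
-/

noncomputable section

open Topology

namespace Literature.AnabelianGeometry.AbsoluteAnabelian

namespace FundamentalExtension

variable {E : FundamentalExtension.{0}}

/-! ### Thm 2.6 (iii) as typed, almost pro-`Σ` case -/

/-- **Residual form of [AbsTopI] Thm 2.6 (iii), almost pro-`Σ` case**: under the hypotheses of the first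
clause (`G ≅ G_K`, `Π` tfg, `Δ` almost pro-`Σ`) the typed predicate `E.Thm26iii S` is equivalent to the bare
reverse inclusion of its second clause. [cite: MochizukiAbsTopI2012, Thm 2.6 (iii) p.22] -/
theorem thm26iii_iff_of_isAlmostPro (B : E.MLFBase) {S : Set ℕ}
    (htfg : IsTopologicallyFinitelyGenerated E.arith) (hpro : IsAlmostPro E.geom S) :
    E.Thm26iii S ↔
      (2 ≤ (thetaSet E.arith 1).encard → {l ∈ S | l.Prime} ⊆ thetaSet E.arith 2) := by
  have h1 : thetaSet E.arith 2 ⊆ {l ∈ S | l.Prime} := E.thetaSet_two_subset_of_isAlmostPro B htfg hpro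
  unfold Thm26iii
  constructor
  · rintro ⟨-, h2⟩ hθ
    rw [h2 hθ]
  · intro h
    exact ⟨h1, fun hθ => Set.Subset.antisymm h1 (h hθ)⟩

/-- **[AbsTopI] Thm 2.6 (iii) (typed `E.Thm26iii S`), both clauses, from the Lemma 2.7 (iii) hook, for `Δ`
ALMOST pro-`Σ`** (twin of abc-iut-w6-d034's `MLFBase.thm26iii_of_hook`): inputs MLF base data, `Π` tfg,
`IsAlmostPro E.geom S`, and the hook. [cite: MochizukiAbsTopI2012, Thm 2.6 (iii) p.22] -/
theorem MLFBase.thm26iii_of_hook_of_isAlmostPro (B : E.MLFBase) {S : Set ℕ}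
    (htfg : IsTopologicallyFinitelyGenerated E.arith) (hΔS : IsAlmostPro E.geom S)
    (hook : ∀ (J : Subgroup E.arith), IsOpen (J : Set E.arith) →
      (∃ (l₀ : ℕ) (_ : Fact l₀.Prime), l₀ ∈ S ∧
        freeProlRank (J.map E.aug.toMonoidHom) l₀ < freeProlRank J l₀) →
      {l ∈ S | l.Prime} ⊆ thetaSet J 2) :
    E.Thm26iii S := by
  refine (thm26iii_iff_of_isAlmostPro B htfg hΔS).2 fun h2 => ?_
  have htop : IsOpen ((⊤ : Subgroup E.arith) : Set E.arith) := by
    rw [Subgroup.coe_top]; exact isOpen_univ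
  obtain ⟨e⟩ := nonempty_continuousMulEquiv_of_eq_top (⊤ : Subgroup E.arith) rfl
  rw [← thetaSet_eq_of_continuousMulEquiv e 1] at h2
  rw [← thetaSet_eq_of_continuousMulEquiv e 2]
  exact MLFBase.subset_thetaSet_two_of_hook_of_isAlmostPro B hΔS hook ⊤ htop h2

/-- **[AbsTopI] Thm 2.6 (iii) AS TYPED for `Δ` ALMOST pro-`Σ`, PROVED MODULO exactly Lemma 2.7 (iii)**
(abc-iut-w6-d073's `Lem27iiiStep`): MLF base data, `Π` tfg, `IsAlmostPro E.geom S`, `Lem27iiiStep` ⟹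
`E.Thm26iii S` — twin of `thm26iii_of_lem27iiiStep`. [cite: MochizukiAbsTopI2012, Thm 2.6 (iii) p.22] -/
theorem thm26iii_of_lem27iiiStep_of_isAlmostPro (B : E.MLFBase) {S : Set ℕ}
    (htfg : IsTopologicallyFinitelyGenerated E.arith) (hpro : IsAlmostPro E.geom S)
    (h27 : E.Lem27iiiStep S) : E.Thm26iii S :=
  MLFBase.thm26iii_of_hook_of_isAlmostPro B htfg hpro (subset_thetaSet_two_of_rankExcess h27)

/-- **Thm 2.6 (iii) for every open `H ⊆ Π`, for `Δ` ALMOST pro-`Σ`, PROVED MODULO Lemma 2.7 (iii)** — both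
clauses, in the shape of the input `hiii` of the Thm 2.6 (v) closers (twin of `thm26iii_open_of_lem27iiiStep`).
[cite: MochizukiAbsTopI2012, Thm 2.6 (iii) p.22] -/
theorem thm26iii_open_of_lem27iiiStep_of_isAlmostPro (B : E.MLFBase) {S : Set ℕ}
    (htfg : IsTopologicallyFinitelyGenerated E.arith) (hpro : IsAlmostPro E.geom S)
    (h27 : E.Lem27iiiStep S) :
    ∀ (H : Subgroup E.arith), IsOpen (H : Set E.arith) →
      thetaSet ↥H 2 ⊆ {l ∈ S | l.Prime} ∧
        (2 ≤ (thetaSet ↥H 1).encard → thetaSet ↥H 2 = {l ∈ S | l.Prime}) := by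
  intro H hH
  have h1 := MLFBase.thetaSet_two_subset_of_isOpen_of_isAlmostPro B htfg hpro H hH
  exact ⟨h1, fun hθ =>
    Set.Subset.antisymm h1 (subset_thetaSet_two_of_lem27iiiStep_of_isAlmostPro B hpro h27 hH hθ)⟩

/-! ### Thm 2.6 (v), general `Θ`, almost pro-`Σ` case -/

/-- **[AbsTopI] Thm 2.6 (v), general form, for `Δ` ALMOST pro-`Σ`, PROVED MODULO ⟨Prop 2.2, `Π` tfg, the
(ii)-rank identity per open `Π′`, Lemma 2.7 (iii)⟩** — abc-iut-w6-d071's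
`MLFBase.thm26vFull_of_rank_of_thm26iii_open_of_isAlmostPro` with its input `hiii` discharged by
`thm26iii_open_of_lem27iiiStep_of_isAlmostPro` (twin of `MLFBase.thm26vFull_of_rank_of_lem27iiiStep`).
[cite: MochizukiAbsTopI2012, Thm 2.6 (v) p.22] -/
theorem MLFBase.thm26vFull_of_rank_of_lem27iiiStep_of_isAlmostPro (B : E.MLFBase) (S : Set ℕ)
    (hS : S ⊆ {q | q.Prime}) (hΔ : E.GeomTFG) (htfg : IsTopologicallyFinitelyGenerated E.arith)
    (hΔS : IsAlmostPro E.geom S)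
    (hQ : ∀ (P : Subgroup E.arith), IsOpen (P : Set E.arith) → ∃ m : ℕ, ∀ (l : ℕ) [Fact l.Prime],
      l ∈ S → freeProlRank P l = freeProlRank (P.map E.aug.toMonoidHom) l + m)
    (h27 : E.Lem27iiiStep S) : E.Thm26vFull B :=
  MLFBase.thm26vFull_of_rank_of_thm26iii_open_of_isAlmostPro B S hS hΔ hΔS hQ
    (thm26iii_open_of_lem27iiiStep_of_isAlmostPro B htfg hΔS h27)

/-- **[AbsTopI] Thm 2.6 (v), general form, every `Σ ⊆ 𝔓𝔯𝔦𝔪𝔢𝔰`, for `Δ` ALMOST pro-`Σ`, PROVED MODULO ⟨Prop 2.2,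
`Π` tfg, the (ii)-rank identity per open `Π′` (only when every prime lies in `Σ`), Lemma 2.7 (iii) (idem)⟩** —
abc-iut-w6-d071's `MLFBase.thm26vFull_of_isAlmostPro_of_tfg` with its input `hiii₂` discharged from
`Lem27iiiStep` (clause two, `subset_thetaSet_two_of_lem27iiiStep_of_isAlmostPro`) and clause one
(`MLFBase.thetaSet_two_subset_of_isOpen_of_isAlmostPro`); twin of `MLFBase.thm26vFull_of_lem27iiiStep`.
[cite: MochizukiAbsTopI2012, Thm 2.6 (v) p.22] -/
theorem MLFBase.thm26vFull_of_lem27iiiStep_of_isAlmostPro (B : E.MLFBase) (S : Set ℕ)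
    (hS : S ⊆ {q | q.Prime}) (hΔ : E.GeomTFG) (htfg : IsTopologicallyFinitelyGenerated E.arith)
    (hΔS : IsAlmostPro E.geom S)
    (hQ : (∀ q : ℕ, q.Prime → q ∈ S) → ∀ (P : Subgroup E.arith), IsOpen (P : Set E.arith) →
      ∃ m : ℕ, ∀ (l : ℕ) [Fact l.Prime],
        freeProlRank P l = freeProlRank (P.map E.aug.toMonoidHom) l + m)
    (h27 : (∀ q : ℕ, q.Prime → q ∈ S) → E.Lem27iiiStep S) : E.Thm26vFull B := by
  refine MLFBase.thm26vFull_of_isAlmostPro_of_tfg B S hS hΔ htfg hΔS hQ fun hall H hH hθ => ?_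
  have h1 := MLFBase.thetaSet_two_subset_of_isOpen_of_isAlmostPro B htfg hΔS H hH
  have h2 := subset_thetaSet_two_of_lem27iiiStep_of_isAlmostPro B hΔS (h27 hall) hH hθ
  refine Set.Subset.antisymm (fun l hl => (h1 hl).2) fun l hl => h2 ⟨hall l hl, hl⟩

/-! ### v2 (APPEND-ONLY, 2026-08-26): Thm 2.6 (v), general `Θ`, from the PRINTED (ii)-inputs — splitting + (∗)_Σ -/

/-- **[AbsTopI] Thm 2.6 (v), general form, every `Σ ⊆ 𝔓𝔯𝔦𝔪𝔢𝔰`, for `Δ` ALMOST pro-`Σ`, with the (ii)-rank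
identity per open `Π′` SUPPLIED by the printed inputs of (ii)** — a splitting over an open subgroup of `G`
("a rational point of `A` over some finite extension of `k`", `E.SplitsOverOpenSubgroup`) and condition (∗)_Σ
(`E.SigmaStarCondition S`, "the `ℤ_l`-ranks of `R_l`, `Q_l` are independent of `l ∈ Σ`", via
`exists_freeProlRank_open_eq_add_of_sigmaStar`) —, PROVED MODULO ⟨Prop 2.2 `E.GeomTFG`, `Π` tfg, and, only
when every prime lies in `Σ`, the Lemma 2.7 (iii) step `Lem27iiiStep`⟩.  (abc-iut-w6-d074's announced
`lem27iiiStep_of_sigmaStarCondition` would discharge the last input from the same (∗)_Σ + splitting.)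
[cite: MochizukiAbsTopI2012, Thm 2.6 (v) p.22] -/
theorem MLFBase.thm26vFull_of_sigmaStarCondition_of_lem27iiiStep_of_isAlmostPro (B : E.MLFBase)
    (S : Set ℕ) (hS : S ⊆ {q | q.Prime}) (hΔ : E.GeomTFG)
    (htfg : IsTopologicallyFinitelyGenerated E.arith) (hΔS : IsAlmostPro E.geom S)
    (hs : E.SplitsOverOpenSubgroup) (hstarS : E.SigmaStarCondition S)
    (h27 : (∀ q : ℕ, q.Prime → q ∈ S) → E.Lem27iiiStep S) : E.Thm26vFull B := by
  refine MLFBase.thm26vFull_of_lem27iiiStep_of_isAlmostPro B S hS hΔ htfg hΔS (fun hall P hP => ?_) h27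
  obtain ⟨m, hon, -⟩ := E.exists_freeProlRank_open_eq_add_of_sigmaStar hs hstarS P hP
  exact ⟨m, fun l _ => hon l (hall l Fact.out)⟩

/-- The same with "`Π` topologically finitely generated" supplied, as in print (proof of (ii) p. 23), from
Prop 2.2 (`E.GeomTFG`) and "`G` topologically finitely generated" ([NSW] Thm 7.5.10, hypothesis `hG`).
[cite: MochizukiAbsTopI2012, Thm 2.6 (v) p.22] -/
theorem MLFBase.thm26vFull_of_sigmaStarCondition_of_lem27iiiStep_of_isAlmostPro_of_geomTFG
    (B : E.MLFBase) (S : Set ℕ) (hS : S ⊆ {q | q.Prime}) (hΔ : E.GeomTFG)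
    (hG : IsTopologicallyFinitelyGenerated E.gal) (hΔS : IsAlmostPro E.geom S)
    (hs : E.SplitsOverOpenSubgroup) (hstarS : E.SigmaStarCondition S)
    (h27 : (∀ q : ℕ, q.Prime → q ∈ S) → E.Lem27iiiStep S) : E.Thm26vFull B :=
  MLFBase.thm26vFull_of_sigmaStarCondition_of_lem27iiiStep_of_isAlmostPro B S hS hΔ
    (IsTopologicallyFinitelyGenerated.of_extension E.aug E.aug_surjective hΔ hG) hΔS hs hstarS h27

end FundamentalExtension

end Literature.AnabelianGeometry.AbsoluteAnabelian

end
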